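import Literature.Analysis.FluidPDE.TorusNSSerrinCriterion
import Literature.Analysis.FluidPDE.TorusNSFoiasGuillopeTemam
import Literature.Analysis.FluidPDE.TorusStrainVorticityOrthogonality
import Literature.Analysis.FluidPDE.TorusVorticityMomentLadder
import HarnessLib

/-!
# Tran–Yu's vortex-stretching depletion criterion on `T³`:
# `∫ ω·(ω·∇)u ≤ C ‖ω‖^{3−θ}_{L^{3−θ}}` with `θ ≥ 1/5` prevents blow-up

Analysis/FluidPDE proof file (theorems only; no definitions, no named facts).

search for candidate a priori estimates; no regularity claim (cell `pub-nsfunc`, literature seat: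
this file types a PUBLISHED conditional regularity criterion — a quantified "depletion of
nonlinearity" hypothesis on the vortex-stretching integral, measured against a Lebesgue norm of
the vorticity — exactly the shape `dF/dt ≤ C·(controlled quantity)^{power}` the cell's census
tests; nothing new).

Source: C. V. Tran, X. Yu, *Depletion of nonlinearity in the pressure force driving Navier–Stokes
flows*, Nonlinearity 28 (2015) 1295–1306, §3.1, eqs. (28)–(34) (held text
`paper:doi-10-1088-0951-7715-28-5-1295`, pp. 6–7). Printed (ℝ³, `ν = 1`):

"By taking the curl of the momentum equation one obtains the vorticity equation
`∂ω/∂t + (u·∇)ω = (ω·∇)u + Δω` (28). The evolution of `‖ω‖²_{L²}` is governed by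
`½ d/dt ‖ω‖²_{L²} = ∫ ω·(ω·∇)u dx − ‖∇ω‖²_{L²}` (29). Suppose that
`∫ ω·(ω·∇)u dx ≤ C ∫|ω|^{3−θ} dx = C‖ω‖^{3−θ}_{L^{3−θ}}` (30), where `C(t)` is a bounded function
… and `0 ≤ θ ≤ 1`. Here, `θ` can be thought of as a measure of nonlinear depletion, with `θ = 1`
and `θ = 0` corresponding to complete and no depletion, respectively. By using
Gagliardo–Nirenberg's inequality we can write `‖ω‖^{3−θ}_{L^{3−θ}} ≤ c‖ω‖^{(3+θ)/2}_{L²}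
‖∇ω‖^{3(1−θ)/2}_{L²}` (31). Substituting this estimate into (29) yields
`½ d/dt‖ω‖²_{L²} ≤ C‖ω‖^{(3+θ)/2}_{L²}‖∇ω‖^{3(1−θ)/2}_{L²} − ‖∇ω‖²_{L²} ≤ C‖ω‖^{2(3+θ)/(1+3θ)}_{L²}`
(32) where Young's inequality has been used. Consider `θ = 1/5`, equation (32) then becomes
`d/dt‖ω‖_{L²} ≤ C‖ω‖³_{L²}` (33). It follows that
`‖ω‖_{L²} ≤ ‖ω₀‖_{L²} exp{∫₀ᵗ C‖ω‖²_{L²} dτ} < ∞` (34), and regularity is secured. Note that the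
same conclusion holds for `θ > 1/5`. Hence, a nonlinear depletion in the vortex stretching term
represented by (30) with `θ ≥ 1/5` is adequate for regularity."

Here on the unit torus `T^d`, `card d = 3`, in the tree's classical vocabulary and in CONTINUATION
FORM at a putative blow-up time: the stretching integral `∫ ω·(ω·∇)u = ∫ ωᵀSω` is the tree's
`∫ torusStretchingDensity u` (`= ∫⟪(u·∇)u, Δu⟫`, the inertial term of the enstrophy balance,
`StrainVorticityOrthogonality.integral_inner_convect_laplacian_eq_integral_torusStretchingDensity`),
`|ω|²` is
`torusVorticitySqAt u`, and (30) is taken with a constant `C` (a bounded `C(t) ≤ C₀` gives (30)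
with the constant `max C₀ 0`, the right-hand side being non-negative).

* `TranYu2015.exists_integral_gradNorm_rpow_le` — the Gagliardo–Nirenberg step (31) on `T³`,
  for the velocity GRADIENT: for `2 ≤ q < 6` there is `K ≥ 0` with
  `∫ |∇v|^q ≤ K (∫|∇v|²)^{(6−q)/4} (∫|Δv|²)^{3(q−2)/4}` for every smooth `v`
  (`|∇v|² = ∑ⱼ‖∂ⱼv‖²`; the tree's interpolation `Torus.integral_rpow_le_interpolate_two_six` and
  its Sobolev step `Torus.exists_integral_gradSq_cube_le_laplacianSq_cube`, RRS 2016 Lemma 8.16);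
  since `|ω|² ≤ 2|∇v|²` pointwise and `‖∇ω‖₂ = ‖Δv‖₂`, this is (31) up to the constant.
* `TranYu2015.exists_enstrophyFlux_le_rpow_of_stretching_le` — **(32)** on `T³` for the whole
  printed range `0 ≤ θ ≤ 1`: for `ν > 0`, `C ≥ 0` there is `K ≥ 0` such that every smooth
  divergence-free `v` with `∫ ωᵀSω ≤ C ∫|ω|^{3−θ}` has enstrophy flux
  `−ν‖Δv‖₂² + ∫⟪(v·∇)v, Δv⟫ ≤ K (‖∇v‖₂²)^{(3+θ)/(1+3θ)}` = the printed `C‖ω‖₂^{2(3+θ)/(1+3θ)}`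
  (`‖∇v‖₂ = ‖ω‖₂`; weighted AM–GM with weights `(1+3θ)/4`, `3(1−θ)/4` against `ν‖Δv‖₂²`).
* `TranYu2015.exists_enstrophyFlux_le_of_stretching_le` — (32)–(33) for `1/5 ≤ θ ≤ 1`: the
  exponent `(3+θ)/(1+3θ)` is `≤ 2` exactly when `θ ≥ 1/5`, whence the flux is
  `≤ K (1 + ‖∇v‖₂²) ‖∇v‖₂²` — a Grönwall coefficient integrable in time by the energy inequality.
* `Torus.classicalNS_continuation_of_stretching_le_vorticity_rpow` — **(30) ⇒ (34) on `T³`**: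
  along a classical solution of the unforced equations (`ν > 0`, mean-zero slices) on
  `[0, T) × T^d`, `card d = 3`, if `∫ ωᵀSω (t) ≤ C ∫|ω(t)|^{3−θ}` for all `t ∈ [0, T)` with
  `1/5 ≤ θ ≤ 1`, the solution continues past `T` — Grönwall through the tree's enstrophy door
  `Torus.classicalNS_continuation_of_enstrophyFlux_le` with `g = 2K(1 + ‖∇u(t)‖₂²)`, whose
  primitive is bounded by the energy inequality `∫₀ᵗ‖∇u‖₂² ≤ ‖u₀‖₂²/(2ν)`
  (`Torus.classicalNS_integral_gradNormSq_le`) — the printed "(34) `< ∞`".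

* `TranYu2015.exists_integral_torusStretchingDensity_le_vorticity_cube` — **the endpoint
  `θ = 0` ("no depletion") is unconditional** on `𝕋³`: there is `K ≥ 0` with
  `∫ ωᵀSω ≤ K ∫ |ω|³` for EVERY smooth divergence-free `v` (pointwise `|ωᵀSω| ≤ |ω|²|∇v|`,
  Hölder `3/2`–`3`, and the periodic div–curl bound `‖∇v‖_{L³} ≤ K₃‖ω‖_{L³}`,
  `Torus.exists_gradLs_le_vorticityLs`); this is the "direct estimate"
  `d/dt ½‖ω‖₂² ≤ −ν‖ω‖²_{Ḣ¹} + C‖ω‖₃³` of Lemarié-Rieusset 2016, Ch. 11 (proof of Thm 11.7), so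
  that (30) interpolates between no assumption (`θ = 0`, growth law with exponent `3`, the cubic
  law's shape — `TranYu2015.exists_enstrophyFlux_le_gradNormSq_cube`) and complete depletion
  (`θ = 1`).

Scope (faithfulness): classical solutions with mean-zero velocity slices on the unit torus (the
paper: ℝ³, formal); constant `C ≥ 0` in (30) (see above); `1/5 ≤ θ ≤ 1` in the criterion (the
printed range for which regularity is claimed; for `0 ≤ θ < 1/5` only the growth law (32) is
printed, and typed); constants existential (the tree's `L⁶` Sobolev constant is). The remark
on Donzis et al.'s ordered set `‖ω‖_{L^{2m}}^{(m+2)/(2m+1)…}` (p. 7) is not a theorem and is not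
typed.

## Mathlib / tree search

Tree (used): `Torus.integral_rpow_le_interpolate_two_six`,
`Torus.exists_integral_gradSq_cube_le_laplacianSq_cube` (`TorusNSSerrinCriterion`),
`Torus.classicalNS_continuation_of_enstrophyFlux_le` (`TorusNSEnstrophyContinuation`),
`Torus.classicalNS_integral_gradNormSq_le` (`TorusNSFoiasGuillopeTemam`),
`integral_inner_convect_laplacian_eq_integral_torusStretchingDensity`
(`TorusStrainVorticityOrthogonality`), `torusVorticitySqAt_le_two_mul_sum_norm_sq`
(`ExtremeGrowthVorticityControl`), `Torus.IsSmoothSpaceTimeOn.continuousOn_gradNormSq`,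
`VorticityMomentLadder.abs_torusStretchingDensity_le_mul_sqrt` (`TorusVorticityMomentLadder`),
`Torus.exists_gradLs_le_vorticityLs` (`TorusNSVorticityLsCriterion`); Mathlib
`Real.geom_mean_le_arith_mean2_weighted`, `integral_mul_le_Lp_mul_Lq_of_nonneg`. Searched
(`lean search`):
`depletion|three_sub_theta|stretching_le_vorticity_rpow|14/5` — the tree has the stretching
BOUNDS `|∫σ| ≤ …` (`TorusVorticityMomentLadder`, `TorusNSDirectionDissipation`) and the doors, not
this conditional criterion — added here.

## References

* [TranYu2015] C. V. Tran, X. Yu, *Depletion of nonlinearity in the pressure force driving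
  Navier–Stokes flows*, Nonlinearity 28 (2015) 1295–1306, doi:10.1088/0951-7715/28/5/1295 —
  §3.1 eqs. (28)–(34) (held text pp. 6–7).
* [RobinsonRodrigoSadowskiCUP2016] J. C. Robinson, J. L. Rodrigo, W. Sadowski, *The
  Three-Dimensional Navier–Stokes Equations*, CUP 2016, Lemma 8.16 (interpolation
  `‖∇u‖_{L^{2s/(s−2)}} ≤ ‖∇u‖^{(s−3)/s}_{L²}‖∇u‖^{3/s}_{L⁶}`), Lemma 6.11, via the tree files above.
* [Miller2026StrainVorticity] E. Miller, Pure Appl. Anal. 8 (2026) 247–270, §6 (6.3)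
  (`d/dt ½‖ω‖² = −‖ω‖²_{Ḣ¹} + ⟨S, ω⊗ω⟩`, the bridge identity, via the tree).
* [LemarieRieusset2016] P. G. Lemarié-Rieusset, *The Navier–Stokes Problem in the 21st Century*,
  CRC 2016, Ch. 11, proof of Thm 11.7 ("a direct estimate would give
  `d/dt(‖ω‖₂²/2) ≤ −(ν/2)‖ω‖²_{Ḣ¹} + … + C‖ω‖₃³`", §"Vorticity direction").
* [MajdaBertozziCUP2002] A. J. Majda, A. L. Bertozzi, *Vorticity and Incompressible Flow*, CUP
  2002, §11.1 (11.9) with Prop. 10.6 (`‖∇v‖_{L^p} ≤ C_p‖ω‖_{L^p}`, via the tree).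
-/

noncomputable section

open MeasureTheory Finset Set Filter Topology
open scoped InnerProductSpace RealInnerProductSpace ContDiff

namespace Literature.Analysis.FluidPDE

open Literature.Analysis.FunctionSpaces

variable {d : Type*} [Fintype d] [DecidableEq d]

namespace TranYu2015

/-! ### §1 The Gagliardo–Nirenberg step (31) for the velocity gradient on `T³` -/

/-- **Gagliardo–Nirenberg for `|∇v|` on `T³`** (Tran–Yu 2015, (31):
"`‖ω‖^{3−θ}_{L^{3−θ}} ≤ c‖ω‖^{(3+θ)/2}_{L²}‖∇ω‖^{3(1−θ)/2}_{L²}`", here for the full gradient,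
which dominates the vorticity pointwise): for `2 ≤ q < 6` there is `K ≥ 0` such that for every
smooth `v : T^d → ℝ^d`, `card d = 3`,
`∫ (∑ⱼ‖∂ⱼv‖²)^{q/2} ≤ K (∫∑ⱼ‖∂ⱼv‖²)^{(6−q)/4} (∫‖Δv‖²)^{3(q−2)/4}`
(Hölder interpolation between `L²` and `L⁶`, `Torus.integral_rpow_le_interpolate_two_six` with
`s = 2q/(q−2)`, and the Sobolev step `∫|∇v|⁶ ≤ C(∫|Δv|²)³`,
`Torus.exists_integral_gradSq_cube_le_laplacianSq_cube`; `q = 2` is the identity).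
[cite: TranYu2015, eq. (31); RobinsonRodrigoSadowskiCUP2016, Lemma 8.16 (proof)] -/
theorem exists_integral_gradNorm_rpow_le (hd : Fintype.card d = 3) {q : ℝ} (hq2 : 2 ≤ q)
    (hq6 : q < 6) :
    ∃ K : ℝ, 0 ≤ K ∧ ∀ v : UnitAddTorus d → EuclideanSpace ℝ d, Torus.IsSmooth v →
      ∫ x, (∑ j, ‖Torus.partialDeriv j v x‖ ^ 2) ^ (q / 2) ≤
        K * Torus.gradNormSq v ^ ((6 - q) / 4) *
          (∫ x, ‖Torus.laplacian v x‖ ^ 2) ^ (3 * (q - 2) / 4) := by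
  obtain ⟨C₆, hC₆0, hC₆⟩ := Torus.exists_integral_gradSq_cube_le_laplacianSq_cube (d := d) hd
  rcases hq2.eq_or_lt with h2 | h2
  · -- `q = 2`: `∫|∇v|² = ‖∇v‖₂²`
    subst h2
    refine ⟨1, zero_le_one, fun v hv => ?_⟩
    have e1 : ∫ x, (∑ j, ‖Torus.partialDeriv j v x‖ ^ 2) ^ ((2 : ℝ) / 2) = Torus.gradNormSq v := by
      rw [Torus.gradNormSq]
      exact integral_congr_ae (ae_of_all _ fun x => by norm_num)
    rw [e1]
    norm_num
  · refine ⟨C₆ ^ ((q - 2) / 4), Real.rpow_nonneg hC₆0 _, fun v hv => ?_⟩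
    -- exponent bookkeeping: `s = 2q/(q−2) > 3`, `2s/(s−2) = q`, `(s−3)/(s−2) = (6−q)/4`,
    -- `1/(s−2) = (q−2)/4`
    have hq0 : 0 < q - 2 := by linarith
    set s : ℝ := 2 * q / (q - 2) with hs
    have hs3 : 3 < s := by
      rw [hs, lt_div_iff₀ hq0]; linarith
    have hs2 : s - 2 = 4 / (q - 2) := by rw [hs]; field_simp; ring
    have he1 : 2 * s / (s - 2) = q := by
      rw [hs2, hs]; field_simp; ring
    have he2 : (s - 3) / (s - 2) = (6 - q) / 4 := by
      rw [hs2, show s - 3 = (6 - q) / (q - 2) by rw [hs]; field_simp; ring]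
      field_simp
    have he3 : 1 / (s - 2) = (q - 2) / 4 := by rw [hs2]; field_simp
    -- `f = |∇v|`
    set S : UnitAddTorus d → ℝ := fun x => ∑ j, ‖Torus.partialDeriv j v x‖ ^ 2 with hSdef
    have hS0 : ∀ x, 0 ≤ S x := fun x => Finset.sum_nonneg fun _ _ => sq_nonneg _
    have hSc : Continuous S :=
      continuous_finsetSum _ fun j _ => ((hv.partialDeriv j).continuous.norm).pow 2
    set f : UnitAddTorus d → ℝ := fun x => Real.sqrt (S x) with hfdef
    have hf0 : ∀ x, 0 ≤ f x := fun x => Real.sqrt_nonneg _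
    have hfc : Continuous f := hSc.sqrt
    have hf2 : ∀ x, f x ^ 2 = S x := fun x => Real.sq_sqrt (hS0 x)
    have hfq : ∀ x, f x ^ q = S x ^ (q / 2) := fun x => by
      rw [hfdef]
      simp only
      rw [Real.sqrt_eq_rpow, ← Real.rpow_mul (hS0 x)]
      congr 1; ring
    have hf6 : ∀ x, f x ^ (6 : ℕ) = S x ^ 3 := fun x => by
      rw [show (6 : ℕ) = 2 * 3 from rfl, pow_mul, hf2]
    have hI := Torus.integral_rpow_le_interpolate_two_six hs3 hfc hf0
    rw [he1, he2, he3] at hI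
    have e2 : ∫ x, f x ^ 2 = Torus.gradNormSq v := by
      rw [Torus.gradNormSq]; exact integral_congr_ae (ae_of_all _ fun x => hf2 x)
    have e6 : ∫ x, f x ^ 6 = ∫ x, S x ^ 3 := integral_congr_ae (ae_of_all _ fun x => hf6 x)
    have eq_ : ∫ x, f x ^ q = ∫ x, S x ^ (q / 2) := integral_congr_ae (ae_of_all _ fun x => hfq x)
    rw [eq_, e2, e6] at hI
    -- the Sobolev step
    have h6 : ∫ x, S x ^ 3 ≤ C₆ * (∫ x, ‖Torus.laplacian v x‖ ^ 2) ^ 3 := hC₆ v hv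
    have hD0 : 0 ≤ ∫ x, ‖Torus.laplacian v x‖ ^ 2 := integral_nonneg fun x => sq_nonneg _
    have hS30 : 0 ≤ ∫ x, S x ^ 3 := integral_nonneg fun x => pow_nonneg (hS0 x) _
    have hE0 : 0 ≤ Torus.gradNormSq v := Torus.gradNormSq_nonneg _
    have hexp0 : 0 ≤ (q - 2) / 4 := by positivity
    have h7 : (∫ x, S x ^ 3) ^ ((q - 2) / 4) ≤
        C₆ ^ ((q - 2) / 4) * (∫ x, ‖Torus.laplacian v x‖ ^ 2) ^ (3 * (q - 2) / 4) := by
      calc (∫ x, S x ^ 3) ^ ((q - 2) / 4)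
          ≤ (C₆ * (∫ x, ‖Torus.laplacian v x‖ ^ 2) ^ 3) ^ ((q - 2) / 4) :=
            Real.rpow_le_rpow hS30 h6 hexp0
        _ = C₆ ^ ((q - 2) / 4) * (∫ x, ‖Torus.laplacian v x‖ ^ 2) ^ (3 * (q - 2) / 4) := by
            rw [Real.mul_rpow hC₆0 (pow_nonneg hD0 _), ← Real.rpow_natCast,
              ← Real.rpow_mul hD0]
            congr 2; push_cast; ring
    calc ∫ x, S x ^ (q / 2)
        ≤ Torus.gradNormSq v ^ ((6 - q) / 4) * (∫ x, S x ^ 3) ^ ((q - 2) / 4) := hI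
      _ ≤ Torus.gradNormSq v ^ ((6 - q) / 4) *
          (C₆ ^ ((q - 2) / 4) * (∫ x, ‖Torus.laplacian v x‖ ^ 2) ^ (3 * (q - 2) / 4)) :=
          mul_le_mul_of_nonneg_left h7 (Real.rpow_nonneg hE0 _)
      _ = C₆ ^ ((q - 2) / 4) * Torus.gradNormSq v ^ ((6 - q) / 4) *
          (∫ x, ‖Torus.laplacian v x‖ ^ 2) ^ (3 * (q - 2) / 4) := by ring

/-! ### §2 The flux inequality (32) -/

/-- `E^r ≤ E + E²` for `E ≥ 0` and `1 ≤ r ≤ 2`. [folklore] -/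
private theorem rpow_le_self_add_sq {E r : ℝ} (hE : 0 ≤ E) (hr1 : 1 ≤ r) (hr2 : r ≤ 2) :
    E ^ r ≤ E + E ^ 2 := by
  have hsplit : E ^ r = E * E ^ (r - 1) := by
    rw [show r = 1 + (r - 1) by ring, Real.rpow_add' hE (by linarith), Real.rpow_one]
    ring_nf
  rw [hsplit]
  have hE2 : 0 ≤ E ^ 2 := sq_nonneg _
  rcases le_or_gt E 1 with hle | hlt
  · have h1 : E ^ (r - 1) ≤ 1 := Real.rpow_le_one hE hle (by linarith)
    nlinarith [mul_le_mul_of_nonneg_left h1 hE]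
  · have h1 : E ^ (r - 1) ≤ E ^ (1 : ℝ) :=
      Real.rpow_le_rpow_of_exponent_le hlt.le (by linarith)
    rw [Real.rpow_one] at h1
    nlinarith [mul_le_mul_of_nonneg_left h1 hE]

/-- **The enstrophy growth law (32) under the depletion hypothesis (30)** (Tran–Yu 2015, (32):
"Substituting this estimate into (29) yields
`½ d/dt‖ω‖²_{L²} ≤ C‖ω‖^{(3+θ)/2}_{L²}‖∇ω‖^{3(1−θ)/2}_{L²} − ‖∇ω‖²_{L²} ≤ C‖ω‖^{2(3+θ)/(1+3θ)}_{L²}`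
where Young's inequality has been used", for the whole printed range `0 ≤ θ ≤ 1`). On `T^d`,
`card d = 3`: for `0 ≤ θ ≤ 1`, `ν > 0` and `C ≥ 0` there is `K ≥ 0` such that every smooth
divergence-free `v` whose stretching integral satisfies `∫ ωᵀSω ≤ C ∫ |ω|^{3−θ}`
(`∫ torusStretchingDensity v ≤ C ∫ (torusVorticitySqAt v)^{(3−θ)/2}`) has enstrophy flux
`−ν‖Δv‖₂² + ∫⟪(v·∇)v, Δv⟫ ≤ K (‖∇v‖₂²)^{(3+θ)/(1+3θ)}` (`‖∇v‖₂² = ‖ω‖₂²` for divergence-free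
`v`; at `θ = 0` the exponent is `3`, the unconditional cubic law's shape; at `θ = 1` it is `1`).
Proof: the bridge `∫⟪(v·∇)v, Δv⟫ = ∫ ωᵀSω`, `|ω|² ≤ 2|∇v|²`, the Gagliardo–Nirenberg step
`exists_integral_gradNorm_rpow_le` (`q = 3 − θ`), and the weighted AM–GM inequality with weights
`(1+3θ)/4, 3(1−θ)/4` against `ν‖Δv‖₂²`. [cite: TranYu2015, eqs. (31)–(32)] -/
theorem exists_enstrophyFlux_le_rpow_of_stretching_le (hd : Fintype.card d = 3) {θ ν C : ℝ}
    (hθ : 0 ≤ θ) (hθ1 : θ ≤ 1) (hν : 0 < ν) (hC : 0 ≤ C) :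
    ∃ K : ℝ, 0 ≤ K ∧ ∀ v : UnitAddTorus d → EuclideanSpace ℝ d, Torus.IsSmooth v →
      Torus.IsDivFree v →
        ∫ x, torusStretchingDensity v x ≤ C * ∫ x, torusVorticitySqAt v x ^ ((3 - θ) / 2) →
          -ν * (∫ x, ‖Torus.laplacian v x‖ ^ 2) +
              ∫ x, ⟪Torus.convect v v x, Torus.laplacian v x⟫ ≤
            K * Torus.gradNormSq v ^ ((3 + θ) / (1 + 3 * θ)) := by
  -- exponents: `q = 3 − θ ∈ [2, 3]`, `e = (6−q)/4 = (3+θ)/4`, `δ = 3(q−2)/4 = 3(1−θ)/4`,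
  -- `1 − δ = (1+3θ)/4`, `r = e/(1−δ) = (3+θ)/(1+3θ)`
  set q : ℝ := 3 - θ with hq
  have hq2 : 2 ≤ q := by rw [hq]; linarith
  have hq6 : q < 6 := by rw [hq]; linarith
  obtain ⟨K₁, hK₁0, hK₁⟩ := exists_integral_gradNorm_rpow_le (d := d) hd hq2 hq6
  set e : ℝ := (6 - q) / 4 with he
  set δ : ℝ := 3 * (q - 2) / 4 with hδ
  have hδ0 : 0 ≤ δ := by rw [hδ]; nlinarith
  have hδ1 : δ ≤ 3 / 4 := by rw [hδ, hq]; linarith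
  have h1δ : 0 < 1 - δ := by linarith
  set r : ℝ := e / (1 - δ) with hr
  have hr_eq : r = (3 + θ) / (1 + 3 * θ) := by
    have h1 : (1 : ℝ) + 3 * θ ≠ 0 := by linarith
    have he' : e = (3 + θ) / 4 := by rw [he, hq]; ring
    have hd' : 1 - δ = (1 + 3 * θ) / 4 := by rw [hδ, hq]; ring
    have h2 : (1 + 3 * θ) / 4 ≠ (0 : ℝ) := (div_pos (by linarith) (by norm_num)).ne'
    rw [hr, he', hd', div_eq_div_iff h2 h1]
    ring
  -- the constant: `A := C 2^{q/2} K₁`, `K := (A ν^{−δ})^{1/(1−δ)}`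
  set A : ℝ := C * (2 : ℝ) ^ (q / 2) * K₁ with hA
  have hA0 : 0 ≤ A := by rw [hA]; positivity
  set K : ℝ := (A * ν ^ (-δ)) ^ (1 / (1 - δ)) with hK
  have hK0 : 0 ≤ K := Real.rpow_nonneg (mul_nonneg hA0 (Real.rpow_nonneg hν.le _)) _
  refine ⟨K, hK0, fun v hv hdiv hdep => ?_⟩
  rw [← hr_eq]
  -- notation
  set E : ℝ := Torus.gradNormSq v with hE
  set D : ℝ := ∫ x, ‖Torus.laplacian v x‖ ^ 2 with hD
  set S : UnitAddTorus d → ℝ := fun x => ∑ j, ‖Torus.partialDeriv j v x‖ ^ 2 with hSdef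
  have hE0 : 0 ≤ E := Torus.gradNormSq_nonneg _
  have hD0 : 0 ≤ D := integral_nonneg fun x => sq_nonneg _
  have hS0 : ∀ x, 0 ≤ S x := fun x => Finset.sum_nonneg fun _ _ => sq_nonneg _
  have hSc : Continuous S :=
    continuous_finsetSum _ fun j _ => ((hv.partialDeriv j).continuous.norm).pow 2
  have hq20 : 0 ≤ q / 2 := by linarith
  -- Step 1: the bridge and `|ω|^q ≤ 2^{q/2} |∇v|^q`
  have hbridge :=
    StrainVorticityOrthogonality.integral_inner_convect_laplacian_eq_integral_torusStretchingDensity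
      hv hdiv
  have hω : ∫ x, torusVorticitySqAt v x ^ (q / 2) ≤ (2 : ℝ) ^ (q / 2) * ∫ x, S x ^ (q / 2) := by
    rw [← integral_const_mul]
    refine integral_mono_of_nonneg (ae_of_all _ fun x => Real.rpow_nonneg
      (torusVorticitySqAt_nonneg v x) _) ?_ (ae_of_all _ fun x => ?_)
    · exact ((hSc.rpow_const fun x => Or.inr hq20).const_mul _).integrable_unitAddTorus
    · show torusVorticitySqAt v x ^ (q / 2) ≤ (2 : ℝ) ^ (q / 2) * S x ^ (q / 2)
      rw [← Real.mul_rpow (by norm_num) (hS0 x)]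
      exact Real.rpow_le_rpow (torusVorticitySqAt_nonneg v x)
        (torusVorticitySqAt_le_two_mul_sum_norm_sq v x) hq20
  -- Step 2: Gagliardo–Nirenberg
  have hGN : ∫ x, S x ^ (q / 2) ≤ K₁ * E ^ e * D ^ δ := hK₁ v hv
  -- Step 3: the stretching bound `∫σ ≤ A E^e D^δ`
  have hσ : ∫ x, torusStretchingDensity v x ≤ A * E ^ e * D ^ δ := by
    have h2q : 0 ≤ (2 : ℝ) ^ (q / 2) := by positivity
    calc ∫ x, torusStretchingDensity v x ≤ C * ∫ x, torusVorticitySqAt v x ^ ((3 - θ) / 2) := hdep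
      _ = C * ∫ x, torusVorticitySqAt v x ^ (q / 2) := by rw [hq]
      _ ≤ C * ((2 : ℝ) ^ (q / 2) * ∫ x, S x ^ (q / 2)) := mul_le_mul_of_nonneg_left hω hC
      _ ≤ C * ((2 : ℝ) ^ (q / 2) * (K₁ * E ^ e * D ^ δ)) :=
          mul_le_mul_of_nonneg_left (mul_le_mul_of_nonneg_left hGN h2q) hC
      _ = A * E ^ e * D ^ δ := by rw [hA]; ring
  -- Step 4: weighted AM–GM `A E^e D^δ = M^{1−δ} (νD)^δ ≤ (1−δ) M + δ ν D`, `M = K E^r`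
  set M : ℝ := K * E ^ r with hM
  have hM0 : 0 ≤ M := mul_nonneg hK0 (Real.rpow_nonneg hE0 _)
  have hνD0 : 0 ≤ ν * D := mul_nonneg hν.le hD0
  have hK1 : K ^ (1 - δ) = A * ν ^ (-δ) := by
    rw [hK, ← Real.rpow_mul (mul_nonneg hA0 (Real.rpow_nonneg hν.le _)),
      one_div_mul_cancel h1δ.ne', Real.rpow_one]
  have hM1 : M ^ (1 - δ) = A * ν ^ (-δ) * E ^ e := by
    rw [hM, Real.mul_rpow hK0 (Real.rpow_nonneg hE0 _), hK1, ← Real.rpow_mul hE0, hr,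
      div_mul_cancel₀ _ h1δ.ne']
  have hN1 : (ν * D) ^ δ = ν ^ δ * D ^ δ := Real.mul_rpow hν.le hD0
  have hνν : ν ^ (-δ) * ν ^ δ = 1 := by
    rw [Real.rpow_neg hν.le, inv_mul_cancel₀ (Real.rpow_pos_of_pos hν _).ne']
  have hsplit : M ^ (1 - δ) * (ν * D) ^ δ = A * E ^ e * D ^ δ := by
    rw [hM1, hN1]
    calc A * ν ^ (-δ) * E ^ e * (ν ^ δ * D ^ δ)
        = A * E ^ e * D ^ δ * (ν ^ (-δ) * ν ^ δ) := by ring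
      _ = A * E ^ e * D ^ δ := by rw [hνν, mul_one]
  have hyoung : M ^ (1 - δ) * (ν * D) ^ δ ≤ (1 - δ) * M + δ * (ν * D) :=
    Real.geom_mean_le_arith_mean2_weighted h1δ.le hδ0 hM0 hνD0 (by ring)
  -- Step 5: assembly
  calc -ν * D + ∫ x, ⟪Torus.convect v v x, Torus.laplacian v x⟫
      = -ν * D + ∫ x, torusStretchingDensity v x := by rw [hbridge]
    _ ≤ -ν * D + M ^ (1 - δ) * (ν * D) ^ δ := by rw [hsplit]; linarith
    _ ≤ -ν * D + ((1 - δ) * M + δ * (ν * D)) := by linarith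
    _ ≤ (1 - δ) * M := by nlinarith
    _ ≤ M := by nlinarith
    _ = K * E ^ r := rfl

/-- **The enstrophy flux under the depletion hypothesis (30) with `θ ≥ 1/5`** (Tran–Yu 2015,
(32)–(33): "Consider `θ = 1/5`, equation (32) then becomes `d/dt‖ω‖_{L²} ≤ C‖ω‖³_{L²}` (33) …
the same conclusion holds for `θ > 1/5`"; the exponent `2(3+θ)/(1+3θ)` of (32) is `≤ 4` iff
`θ ≥ 1/5`). On `T^d`, `card d = 3`: for `1/5 ≤ θ ≤ 1`, `ν > 0` and `C ≥ 0` there is `K ≥ 0`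
such that every smooth divergence-free `v` whose stretching integral satisfies
`∫ ωᵀSω ≤ C ∫ |ω|^{3−θ}` (`∫ torusStretchingDensity v ≤ C ∫ (torusVorticitySqAt v)^{(3−θ)/2}`)
has enstrophy flux `−ν‖Δv‖₂² + ∫⟪(v·∇)v, Δv⟫ ≤ K (1 + ‖∇v‖₂²) ‖∇v‖₂²`
(`exists_enstrophyFlux_le_rpow_of_stretching_le` and `E^r ≤ E + E²` for the exponent
`r = (3+θ)/(1+3θ) ∈ [1, 2]`) — a Grönwall coefficient `K(1 + ‖∇v‖₂²)` integrable in time by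
the energy inequality. [cite: TranYu2015, eqs. (32)–(33)] -/
theorem exists_enstrophyFlux_le_of_stretching_le (hd : Fintype.card d = 3) {θ ν C : ℝ}
    (hθ : 1 / 5 ≤ θ) (hθ1 : θ ≤ 1) (hν : 0 < ν) (hC : 0 ≤ C) :
    ∃ K : ℝ, 0 ≤ K ∧ ∀ v : UnitAddTorus d → EuclideanSpace ℝ d, Torus.IsSmooth v →
      Torus.IsDivFree v →
        ∫ x, torusStretchingDensity v x ≤ C * ∫ x, torusVorticitySqAt v x ^ ((3 - θ) / 2) →
          -ν * (∫ x, ‖Torus.laplacian v x‖ ^ 2) +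
              ∫ x, ⟪Torus.convect v v x, Torus.laplacian v x⟫ ≤
            K * (1 + Torus.gradNormSq v) * Torus.gradNormSq v := by
  obtain ⟨K, hK0, hK⟩ :=
    exists_enstrophyFlux_le_rpow_of_stretching_le (d := d) hd (by linarith) hθ1 hν hC
  refine ⟨K, hK0, fun v hv hdiv hdep => ?_⟩
  have hE0 : 0 ≤ Torus.gradNormSq v := Torus.gradNormSq_nonneg _
  have h13 : 0 < 1 + 3 * θ := by linarith
  have hr1 : 1 ≤ (3 + θ) / (1 + 3 * θ) := by rw [le_div_iff₀ h13]; linarith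
  have hr2 : (3 + θ) / (1 + 3 * θ) ≤ 2 := by rw [div_le_iff₀ h13]; linarith
  have hEr := rpow_le_self_add_sq hE0 hr1 hr2
  calc -ν * (∫ x, ‖Torus.laplacian v x‖ ^ 2) + ∫ x, ⟪Torus.convect v v x, Torus.laplacian v x⟫
      ≤ K * Torus.gradNormSq v ^ ((3 + θ) / (1 + 3 * θ)) := hK v hv hdiv hdep
    _ ≤ K * (Torus.gradNormSq v + Torus.gradNormSq v ^ 2) := mul_le_mul_of_nonneg_left hEr hK0
    _ = K * (1 + Torus.gradNormSq v) * Torus.gradNormSq v := by ring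

end TranYu2015

/-! ### §3 The criterion: (30) with `θ ≥ 1/5` prevents blow-up on `T³` -/

section Criterion

variable {ν T : ℝ} {u : ℝ → UnitAddTorus d → EuclideanSpace ℝ d} {p : ℝ → UnitAddTorus d → ℝ}

/-- **Tran–Yu's vortex-stretching depletion criterion on `T³` (continuation form).** Printed
(ℝ³, `ν = 1`): "Suppose that `∫ ω·(ω·∇)u dx ≤ C ∫|ω|^{3−θ} dx = C‖ω‖^{3−θ}_{L^{3−θ}}` (30),
where `C(t)` is a bounded function … and `0 ≤ θ ≤ 1` … Consider `θ = 1/5`, equation (32) then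
becomes `d/dt‖ω‖_{L²} ≤ C‖ω‖³_{L²}` (33). It follows that
`‖ω‖_{L²} ≤ ‖ω₀‖_{L²} exp{∫₀ᵗ C‖ω‖²_{L²} dτ} < ∞` (34), and regularity is secured. Note that the
same conclusion holds for `θ > 1/5`. Hence, a nonlinear depletion in the vortex stretching term
represented by (30) with `θ ≥ 1/5` is adequate for regularity." Here: a classical solution of the
unforced Navier–Stokes equations (`ν > 0`) on `[0, T) × T^d`, `card d = 3`, `T > 0`, with
mean-zero velocity slices, `1/5 ≤ θ ≤ 1`, a constant `C`, and for every `t ∈ [0, T)` the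
depletion hypothesis `∫ ωᵀSω (t) ≤ C ∫ |ω(t)|^{3−θ}`
(`∫ torusStretchingDensity (u t) ≤ C ∫ (torusVorticitySqAt (u t))^{(3−θ)/2}`): then the solution
continues to a classical solution with mean-zero slices on some `[0, T'] × T^d`, `T' > T`, equal
to `u` on `[0, T)`. Proof: the flux bound `TranYu2015.exists_enstrophyFlux_le_of_stretching_le`
gives `d/dt ½‖∇u‖₂² ≤ K(1 + ‖∇u‖₂²)‖∇u‖₂²`, the energy inequality
`∫₀ᵗ ‖∇u‖₂² ≤ ‖u₀‖₂²/(2ν)` (`Torus.classicalNS_integral_gradNormSq_le`) bounds the primitive of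
`g = 2K(1 + ‖∇u‖₂²)` by `2K(T + ‖u₀‖₂²/(2ν))` — the printed "(34) `< ∞`" — and the tree's
enstrophy door `Torus.classicalNS_continuation_of_enstrophyFlux_le` concludes.
[cite: TranYu2015, §3.1 eqs. (30)–(34)] -/
theorem Torus.classicalNS_continuation_of_stretching_le_vorticity_rpow (hd : Fintype.card d = 3)
    (hν : 0 < ν) (hT : 0 < T) (h : Torus.IsClassicalNSSolutionOn (Ico 0 T) ν 0 u p)
    (hmean : ∀ t ∈ Ico 0 T, Torus.HasZeroMean (u t)) {θ : ℝ} (hθ : 1 / 5 ≤ θ) (hθ1 : θ ≤ 1)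
    {C : ℝ} (hdep : ∀ t ∈ Ico 0 T, ∫ x, torusStretchingDensity (u t) x ≤
      C * ∫ x, torusVorticitySqAt (u t) x ^ ((3 - θ) / 2)) :
    ∃ T' : ℝ, T < T' ∧ ∃ (u' : ℝ → UnitAddTorus d → EuclideanSpace ℝ d)
      (p' : ℝ → UnitAddTorus d → ℝ), Torus.IsClassicalNSSolutionOn (Icc 0 T') ν 0 u' p' ∧
        (∀ t ∈ Icc 0 T', Torus.HasZeroMean (u' t)) ∧ ∀ t ∈ Ico 0 T, u' t = u t := by
  -- (30) with the non-negative constant `C⁺ = max C 0`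
  set C' : ℝ := max C 0 with hC'
  have hC'0 : 0 ≤ C' := le_max_right _ _
  have hdep' : ∀ t ∈ Ico 0 T, ∫ x, torusStretchingDensity (u t) x ≤
      C' * ∫ x, torusVorticitySqAt (u t) x ^ ((3 - θ) / 2) := fun t ht =>
    (hdep t ht).trans (mul_le_mul_of_nonneg_right (le_max_left _ _)
      (integral_nonneg fun x => Real.rpow_nonneg (torusVorticitySqAt_nonneg _ x) _))
  obtain ⟨K, hK0, hK⟩ :=
    TranYu2015.exists_enstrophyFlux_le_of_stretching_le (d := d) hd hθ hθ1 hν hC'0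
  -- the Grönwall coefficient `g = 2K(1 + ‖∇u‖₂²)`
  set E : ℝ → ℝ := fun t => Torus.gradNormSq (u t) with hE
  have hEc : ContinuousOn E (Ico 0 T) :=
    h.smooth_velocity.continuousOn_gradNormSq (convex_Ico 0 T) (uniqueDiffOn_Ico 0 T)
  have hE0 : ∀ t, 0 ≤ E t := fun t => Torus.gradNormSq_nonneg _
  set U₀ : ℝ := ∫ x, ‖u 0 x‖ ^ 2 with hU₀
  refine Torus.classicalNS_continuation_of_enstrophyFlux_le hd hν hT h hmean
    (g := fun t => 2 * K * (1 + E t)) (continuousOn_const.mul (continuousOn_const.add hEc))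
    (fun t ht => ?_) (I := 2 * K * (T + U₀ / (2 * ν))) fun t ht => ?_
  · have hut : Torus.IsSmooth (u t) := h.smooth_velocity.isSmooth_slice ht
    have hdivt : Torus.IsDivFree (u t) := h.divFree t ht
    have h1 := hK (u t) hut hdivt (hdep' t ht)
    have e : K * (1 + E t) * E t = 2 * K * (1 + E t) * (2⁻¹ * Torus.gradNormSq (u t)) := by
      rw [hE]; ring
    linarith
  · -- `∫₀ᵗ 2K(1 + E) = 2K(t + ∫₀ᵗ E) ≤ 2K(T + ‖u₀‖₂²/(2ν))`
    rcases ht.1.eq_or_lt with h0 | h0t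
    · rw [← h0, intervalIntegral.integral_same]
      have : 0 ≤ U₀ / (2 * ν) := div_nonneg (integral_nonneg fun x => sq_nonneg _) (by linarith)
      positivity
    have hsub : Icc 0 t ⊆ Ico 0 T := fun s hs => ⟨hs.1, hs.2.trans_lt ht.2⟩
    have h' : Torus.IsClassicalNSSolutionOn (Icc 0 t) ν 0 u p := h.mono hsub (uniqueDiffOn_Icc h0t)
    have hen := Torus.classicalNS_integral_gradNormSq_le hν h0t h'
    have hEi : IntervalIntegrable E volume 0 t :=
      ((hEc.mono hsub).mono_dom le_rfl).intervalIntegrable_of_Icc h0t.le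
    have hsplit : ∫ s in (0 : ℝ)..t, 2 * K * (1 + E s) =
        2 * K * (t + ∫ s in (0 : ℝ)..t, E s) := by
      rw [intervalIntegral.integral_const_mul, intervalIntegral.integral_add
        intervalIntegrable_const hEi, intervalIntegral.integral_const, smul_eq_mul, sub_zero,
        mul_one]
    rw [hsplit]
    refine mul_le_mul_of_nonneg_left ?_ (by positivity)
    exact add_le_add ht.2.le hen

end Criterion

/-! ### §4 The endpoint `θ = 0`: hypothesis (30) holds unconditionally on `𝕋³` -/

namespace TranYu2015

/-- Hölder on `T^d` with weights `a + b = 1` for continuous non-negative `f, g`: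
`∫ f g ≤ (∫ f^{1/a})^a (∫ g^{1/b})^b`. [folklore] -/
private theorem integral_mul_le_rpow_mul_rpow' {ι : Type*} [Fintype ι] {f g : UnitAddTorus ι → ℝ}
    (hf : Continuous f) (hg : Continuous g) (hf0 : ∀ x, 0 ≤ f x) (hg0 : ∀ x, 0 ≤ g x) {a b : ℝ}
    (ha : 0 < a) (hb : 0 < b) (hab : a + b = 1) :
    ∫ x, f x * g x ≤ (∫ x, f x ^ a⁻¹) ^ a * (∫ x, g x ^ b⁻¹) ^ b := by
  have hpq : (a⁻¹).HolderConjugate b⁻¹ := Real.HolderConjugate.inv_inv ha hb hab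
  have h := integral_mul_le_Lp_mul_Lq_of_nonneg (μ := volume) hpq (ae_of_all _ hf0)
    (ae_of_all _ hg0) (hf.memLp_of_hasCompactSupport (HasCompactSupport.of_compactSpace f))
    (hg.memLp_of_hasCompactSupport (HasCompactSupport.of_compactSpace g))
  simpa only [one_div, inv_inv] using h

/-- **The stretching integral is unconditionally controlled by `‖ω‖³_{L³}` on `𝕋³`** — the
endpoint `θ = 0` ("no depletion") of Tran–Yu's hypothesis (30) is no assumption: there is `K ≥ 0`
such that for EVERY smooth divergence-free `v : 𝕋³ → ℝ³`,
`∫ ωᵀSω ≤ K ∫ |ω|³` (`∫ torusStretchingDensity v ≤ K ∫ (torusVorticitySqAt v)^{3/2}`). This is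
the "direct estimate" of Lemarié-Rieusset 2016, Ch. 11 (proof of Thm 11.7: "As `εᵢⱼ` is given by
Riesz transforms of `ω`, a direct estimate would give `d/dt(‖ω‖₂²/2) ≤ −(ν/2)‖ω‖²_{Ḣ¹} + … +
C‖ω‖₃³`"). Proof: `|ωᵀSω| ≤ |ω|² |∇v|` pointwise
(`VorticityMomentLadder.abs_torusStretchingDensity_le_mul_sqrt`),
Hölder with exponents `3/2, 3`, and the periodic div–curl bound `‖∇v‖_{L³} ≤ K₃‖ω‖_{L³}`
(`Torus.exists_gradLs_le_vorticityLs`, Majda–Bertozzi (11.9)).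
[cite: LemarieRieusset2016, Ch. 11 (Vorticity direction), proof of Thm 11.7]
[cite: TranYu2015, eq. (30) at θ = 0] -/
theorem exists_integral_torusStretchingDensity_le_vorticity_cube :
    ∃ K : ℝ, 0 ≤ K ∧ ∀ v : UnitAddTorus (Fin 3) → EuclideanSpace ℝ (Fin 3), Torus.IsSmooth v →
      Torus.IsDivFree v →
        ∫ x, torusStretchingDensity v x ≤ K * ∫ x, torusVorticitySqAt v x ^ ((3 : ℝ) / 2) := by
  obtain ⟨K₃, hK₃0, hK₃⟩ := Torus.exists_gradLs_le_vorticityLs (s := 3) (by norm_num)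
  refine ⟨K₃, hK₃0, fun v hv hdiv => ?_⟩
  have hv1 : Torus.IsContDiff 1 v := hv.isContDiff (by simp)
  -- notation: `W = |ω|²`, `G = |∇v|`
  set W : UnitAddTorus (Fin 3) → ℝ := fun x => torusVorticitySqAt v x with hWdef
  set G : UnitAddTorus (Fin 3) → ℝ := fun x => Real.sqrt (∑ j, ‖Torus.partialDeriv j v x‖ ^ 2)
    with hGdef
  have hW0 : ∀ x, 0 ≤ W x := fun x => torusVorticitySqAt_nonneg v x
  have hG0 : ∀ x, 0 ≤ G x := fun x => Real.sqrt_nonneg _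
  have hSc : Continuous fun x => ∑ j, ‖Torus.partialDeriv j v x‖ ^ 2 :=
    continuous_finsetSum _ fun j _ => ((hv.partialDeriv j).continuous.norm).pow 2
  have hGc : Continuous G := hSc.sqrt
  have hWc : Continuous W := by
    have hD : ∀ i j, Continuous fun x => Torus.partialDeriv i v x j := fun i j =>
      ((hv.partialDeriv i).apply j).continuous
    unfold W torusVorticitySqAt
    exact continuous_const.mul (continuous_finsetSum _ fun i _ =>
      continuous_finsetSum _ fun j _ => ((hD i j).sub (hD j i)).pow 2)
  have hσc : Continuous (torusStretchingDensity v) := by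
    have hD : ∀ i j, Continuous fun x => Torus.partialDeriv i v x j := fun i j =>
      ((hv.partialDeriv i).apply j).continuous
    have e : torusStretchingDensity v = fun x => -∑ i, ∑ j,
        (Torus.partialDeriv i v x j - Torus.partialDeriv j v x i) *
          ∑ k, Torus.partialDeriv i v x k * Torus.partialDeriv k v x j := by
      funext x; rfl
    rw [e]
    exact (continuous_finsetSum _ fun i _ => continuous_finsetSum _ fun j _ =>
      ((hD i j).sub (hD j i)).mul (continuous_finsetSum _ fun k _ =>
        (hD i k).mul (hD k j))).neg
  -- Step 1: `∫σ ≤ ∫ |ω|² |∇v|`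
  have h1 : ∫ x, torusStretchingDensity v x ≤ ∫ x, W x * G x :=
    integral_mono hσc.integrable_unitAddTorus ((hWc.mul hGc).integrable_unitAddTorus) fun x =>
      (le_abs_self _).trans
        (VorticityMomentLadder.abs_torusStretchingDensity_le_mul_sqrt hv1 hdiv x)
  -- Step 2: Hölder `3/2`–`3`
  set A : ℝ := ∫ x, W x ^ ((3 : ℝ) / 2) with hA
  have hA0 : 0 ≤ A := integral_nonneg fun x => Real.rpow_nonneg (hW0 x) _
  have h2 : ∫ x, W x * G x ≤ A ^ ((2 : ℝ) / 3) * (∫ x, G x ^ (3 : ℝ)) ^ ((1 : ℝ) / 3) := by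
    have h := integral_mul_le_rpow_mul_rpow' hWc hGc hW0 hG0 (a := 2 / 3) (b := 1 / 3)
      (by norm_num) (by norm_num) (by norm_num)
    have e1 : ((2 : ℝ) / 3)⁻¹ = 3 / 2 := by norm_num
    have e2 : ((1 : ℝ) / 3)⁻¹ = 3 := by norm_num
    rw [e1, e2] at h
    exact h
  -- Step 3: the div–curl bound `‖∇v‖₃ ≤ K₃ ‖ω‖₃`, i.e. `(∫G³)^{1/3} ≤ K₃ A^{1/3}`
  have h3 : (∫ x, G x ^ (3 : ℝ)) ^ ((1 : ℝ) / 3) ≤ K₃ * A ^ ((1 : ℝ) / 3) := by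
    have h := hK₃ v hv hdiv
    have e : ∫ x, Real.sqrt (torusVorticitySqAt v x) ^ (3 : ℝ) = A := by
      rw [hA]
      refine integral_congr_ae (ae_of_all _ fun x => ?_)
      show Real.sqrt (torusVorticitySqAt v x) ^ (3 : ℝ) = W x ^ ((3 : ℝ) / 2)
      rw [Real.sqrt_eq_rpow, ← Real.rpow_mul (hW0 x)]
      norm_num
    rw [e] at h
    exact h
  -- Step 4: assembly `∫σ ≤ A^{2/3} · K₃ A^{1/3} = K₃ A`
  have hA23 : 0 ≤ A ^ ((2 : ℝ) / 3) := Real.rpow_nonneg hA0 _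
  calc ∫ x, torusStretchingDensity v x ≤ ∫ x, W x * G x := h1
    _ ≤ A ^ ((2 : ℝ) / 3) * (∫ x, G x ^ (3 : ℝ)) ^ ((1 : ℝ) / 3) := h2
    _ ≤ A ^ ((2 : ℝ) / 3) * (K₃ * A ^ ((1 : ℝ) / 3)) := mul_le_mul_of_nonneg_left h3 hA23
    _ = K₃ * (A ^ ((2 : ℝ) / 3) * A ^ ((1 : ℝ) / 3)) := by ring
    _ = K₃ * A := by
        rw [← Real.rpow_add' hA0 (by norm_num : (2 : ℝ) / 3 + 1 / 3 ≠ 0)]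
        norm_num

/-- **The unconditional cubic growth law as the `θ = 0` endpoint** (Tran–Yu 2015, (32) at
`θ = 0`: exponent `2(3+θ)/(1+3θ) = 6` on `‖ω‖₂`, i.e. `d/dt ½‖ω‖₂² ≤ C‖ω‖₂⁶`; Lemarié-Rieusset
2016, Ch. 11: "`≤ C(1/ν)‖f‖²_{H¹} + C''ν⁻³‖ω‖₂⁶`"): on `𝕋³` there is `K ≥ 0` with
`−ν‖Δv‖₂² + ∫⟪(v·∇)v, Δv⟫ ≤ K (‖∇v‖₂²)³` for EVERY smooth divergence-free `v` — the general
growth law `exists_enstrophyFlux_le_rpow_of_stretching_le` at `θ = 0` fed with the unconditional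
bound `exists_integral_torusStretchingDensity_le_vorticity_cube` (the tree's sharp form is the
Lu–Doering law `LuDoering2008_enstrophyRate_le_holds`; this corollary only records that the family
(30) starts at "no assumption").
[cite: TranYu2015, eq. (32) at θ = 0]
[cite: LemarieRieusset2016, Ch. 11 (Vorticity direction), proof of Thm 11.7] -/
theorem exists_enstrophyFlux_le_gradNormSq_cube {ν : ℝ} (hν : 0 < ν) :
    ∃ K : ℝ, 0 ≤ K ∧ ∀ v : UnitAddTorus (Fin 3) → EuclideanSpace ℝ (Fin 3), Torus.IsSmooth v →
      Torus.IsDivFree v →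
        -ν * (∫ x, ‖Torus.laplacian v x‖ ^ 2) +
            ∫ x, ⟪Torus.convect v v x, Torus.laplacian v x⟫ ≤
          K * Torus.gradNormSq v ^ (3 : ℝ) := by
  obtain ⟨C, hC0, hC⟩ := exists_integral_torusStretchingDensity_le_vorticity_cube
  obtain ⟨K, hK0, hK⟩ := exists_enstrophyFlux_le_rpow_of_stretching_le (d := Fin 3) (θ := 0)
    (by simp) le_rfl zero_le_one hν hC0
  refine ⟨K, hK0, fun v hv hdiv => ?_⟩
  have h := hK v hv hdiv (by simpa using hC v hv hdiv)
  rw [show ((3 : ℝ) + 0) / (1 + 3 * 0) = 3 by norm_num] at h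
  exact h

end TranYu2015

end Literature.Analysis.FluidPDE

end
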